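import Summits.QuantumFields.BalabanUV.Beta.FP.PeriodisedBorderTables

/-!
# `BalabanUV.Beta.FP.CompositeKernelFunctionalStep` — road «FP» for binder row D1, ROUTE T: **KERNEL RECURSION ⇒ FUNCTIONAL RECURSION** — the lattice half of
# the (C1) order-1 junction F4 as ONE presentation-agnostic Fubini lemma (leaf-02 g29 OFFER O-1, HOME/CLAIMS.log l.55306; an2 g50 W-an2-g50-1 l.55375
# «WANTED — shape (a)»): if a border kernel `𝒦′` at the multiplier component `(κ, x)` is the TOP-PEELED combination
# `θ · Σ_{g,g′ ∈ P} vh g g′ · c g (·) ⊗ c g′ (·) + s · Σ_{g ∈ P} a g · 𝒦_g` of a one-step mixed kernel `vh`, the lower average's kernel `c`, the top linear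
# averaging's kernel `a` and the lower border kernels `𝒦_g` (an2 F3's `compVHKer_succ` SHAPE, `Finset` windows), then its border pairing against two
# 1-forms `(B, H)` IS R-7's successor clause `hsucc`: `θ · Σ'_{u₁}Σ_{κ₁}(Σ'_{z₁}Σ_{l₁} vh (l₁,z₁) (κ₁,u₁) · Cf B l₁ z₁) · Cf H κ₁ u₁ + s · Af (ℐ H B) κ x`
# for ANY functionals `Cf ∕ Af ∕ ℐ` with those kernels; §3 the ORDER-2 twin (bi-kernel recursion ⇒ R-8's `hsucc₂`).  No averaging object is named: `vh, vh2,
# c, a, 𝒦, 𝒲` are abstract (an1's rooted kernels under (α), the sym bricks under (β) — R-D1-g49-2), so the lemmas serve both presentations.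

WHY.  R-7 `TorusCompositeInsertionPeriodic` ∕ R-9 `TorusCompositeInsertionKernel` type the TORUS half of F4 for any functional `𝓘₁` with the clauses `h0 ∕ hsucc`
and any lattice family with the kernel clause `h𝒱`; the row's F3 (S-an2-g49-1 §3′) DEFINES the composite border kernel `compVHKer r L m` by the top-peeled
`Finset` recursion and names `𝓘₁ :=` its border pairing (shape (a)), so that `h𝒱` is `packVH`'s entry lemma and `h0` is `compVHKer_zero`; what is left is
`hsucc` for the pairing — THIS file, once: `pairing_of_kernel_succ`.  The plumbing is one lemma (`tsum_sum_finset_mul_eq`: a finitely supported kernel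
combination paired with a form = the combination of the pairings) used four times, plus `tsum_sum_eq_finset_sum` (a bond `tsum` of a `P`-supported function is
the `Finset` sum over `P`).  [folklore] finite sums + finitely supported `tsum`s BY NAME (Mathlib `Summable.tsum_finsetSum`, `tsum_mul_left`, `tsum_eq_sum`,
`Finset.sum_subset`); no `def`, no `def … : Prop`, nothing cited, 0 sorry; nothing of Bałaban's asserted.  NOT HERE: the kernels (an2 F3 ∕ F5), their windows
and vanishing letters (an1 ∕ K-U3d), units, the torus half (R-7 ∕ R-8 ∕ R-9 ∕ R-10).

HONEST DEPENDENCY (page 1, mandatory): continuum YM on T⁴ ⇐ BetaPertH ∧ nine spine estimates (0/9 proved); BetaPertH ⇐ (D1) ∧ (D4) ∧ CAP+tail;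
G-an2-4 gates asym, D1 and NE2/3/4.  HONEST FRAMING (cell contract, verbatim): «discharging `BetaPertH` makes Bałaban's UV stability UNCONDITIONAL —
a real constructive-QFT result; it is NOT the continuum limit and NOT the Clay problem.»  ABSOLUTE RULE (cell charter, verbatim): «No internally-minted
statement may enter as a cited fact. Every hypothesis is either kernel-proved in this package or a verbatim quotation of a PUBLISHED theorem with page
reference. The manuscript(s) under audit are NOT citable for their own disputed steps — they are the thing under adjudication; programme-internal
(2001/route/tribunal) claims are never citable.»  0 estimates; 0∕4 row-D1 binders (hW, hR, D1Tel, D1Rep); NOT (T-ID), NOT (C1), NOT SDF, NOT D1,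
NOT BetaPertH, NOT continuum, NOT Clay.  D1 formalisation swarm LEAF PROVER 02 (b2b-balaban-beta-d1-formalise-leaf-02 gen 29), 2026-08-23.  No existing file touched.
-/

noncomputable section

open scoped BigOperators

namespace Summit.QuantumFields.BalabanUV.Beta.FP.CompositeKernelFunctionalStep

open Finset
open Literature.MathematicalPhysics.QuantumFieldTheory.Balaban1983to89.Beta
open AffineAveraging (Site Form1)
open AveragingHessianKernels (Bond)

variable {d : ℕ}

/-! ## §1 Plumbing -/

/-- [folklore] a `tsum` over lattice sites of a finite sum over directions of a function of the bond supported in the finite bond set `P` is the sum over `P`. -/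
theorem tsum_sum_eq_finset_sum (P : Finset (Bond (d + 1))) (F : Bond (d + 1) → ℝ) (hF : ∀ p ∉ P, F p = 0) :
    (∑' u : Site (d + 1), ∑ κ : Fin (d + 1), F (κ, u)) = ∑ p ∈ P, F p := by
  classical
  have h1 : (∑' u : Site (d + 1), ∑ κ : Fin (d + 1), F (κ, u)) = ∑ u ∈ P.image Prod.snd, ∑ κ : Fin (d + 1), F (κ, u) := by
    refine tsum_eq_sum fun u hu => Finset.sum_eq_zero fun κ _ => hF _ fun hp => hu ?_
    exact Finset.mem_image.2 ⟨(κ, u), hp, rfl⟩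
  rw [h1, Finset.sum_comm, ← Finset.sum_product']; symm
  refine Finset.sum_subset (fun p hp => Finset.mem_product.2 ⟨Finset.mem_univ _, Finset.mem_image.2 ⟨p, hp, rfl⟩⟩) fun p _ hp => hF p hp

/-- [folklore] **a finitely supported finite combination of kernels paired with a form is the combination of the pairings**:
`Σ'_z Σ_l (Σ_{i ∈ I} φ i · k i l z) · B l z = Σ_{i ∈ I} φ i · Σ'_z Σ_l k i l z · B l z` (each `k i` supported in the finite window `S i`). -/
theorem tsum_sum_finset_mul_eq {ι : Type*} (I : Finset ι) (φ : ι → ℝ) (k : ι → Fin (d + 1) → Site (d + 1) → ℝ)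
    (S : ι → Finset (Site (d + 1))) (hk : ∀ i (l : Fin (d + 1)), ∀ z ∉ S i, k i l z = 0) (B : Form1 (d + 1) ℝ) :
    (∑' z : Site (d + 1), ∑ l : Fin (d + 1), (∑ i ∈ I, φ i * k i l z) * B l z)
      = ∑ i ∈ I, φ i * ∑' z : Site (d + 1), ∑ l : Fin (d + 1), k i l z * B l z := by
  have hsum : ∀ i, Summable fun z : Site (d + 1) => φ i * ∑ l : Fin (d + 1), k i l z * B l z := fun i =>
    summable_of_ne_finset_zero (s := S i) fun z hz => by
      rw [Finset.sum_eq_zero fun l _ => by rw [hk i l z hz, zero_mul], mul_zero]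
  calc (∑' z : Site (d + 1), ∑ l : Fin (d + 1), (∑ i ∈ I, φ i * k i l z) * B l z)
      = ∑' z : Site (d + 1), ∑ i ∈ I, φ i * ∑ l : Fin (d + 1), k i l z * B l z := by
        refine tsum_congr fun z => ?_
        rw [Finset.sum_congr rfl fun l _ => Finset.sum_mul _ _ _, Finset.sum_comm]
        exact Finset.sum_congr rfl fun i _ => by rw [Finset.mul_sum]; exact Finset.sum_congr rfl fun l _ => by ring
    _ = ∑ i ∈ I, ∑' z : Site (d + 1), φ i * ∑ l : Fin (d + 1), k i l z * B l z := Summable.tsum_finsetSum fun i _ => hsum i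
    _ = ∑ i ∈ I, φ i * ∑' z : Site (d + 1), ∑ l : Fin (d + 1), k i l z * B l z := Finset.sum_congr rfl fun i _ => tsum_mul_left

/-! ## §2 The step: kernel recursion ⇒ functional recursion -/

/-- [folklore] **`pairing_of_kernel_succ` — KERNEL RECURSION ⇒ FUNCTIONAL RECURSION (the lattice half of F4, presentation-agnostic).**  Data at a fixed
multiplier component `(κ, x)`: the window `P` (a finite set of bonds read by the top step at `(κ, x)`), the top one-step mixed kernel `vh g g′` (supported in
`P × P`: `hvh`), the top linear averaging kernel `a g` (supported in `P`: `ha`) and functional `Af` (`hAf`: its value at `(κ, x)` is the `a`-combination), the lower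
average's kernel `c g f` with functional `Cf` (`hCf`; `c g` finitely supported in the fine bond: `hc`), the lower border kernels `𝒦 g` with functionals `ℐ`
(`hℐ`; finitely supported in both fine slots: `hKz ∕ hKu`), and the upper border kernel `𝒦′` obeying the TOP-PEELED RECURSION `h𝒦′` (an2 F3's `compVHKer_succ`
SHAPE; `θ, s` the step's scalars).  Conclusion: the border pairing of `𝒦′` against `(B, H)` IS R-7's successor clause:
`Σ'_u Σ_{κ′} (Σ'_z Σ_l 𝒦′ (l,z) (κ′,u) · B l z) · H κ′ u = θ · Σ'_{u₁} Σ_{κ₁} (Σ'_{z₁} Σ_{l₁} vh (l₁,z₁) (κ₁,u₁) · Cf B l₁ z₁) · Cf H κ₁ u₁ + s · Af (ℐ H B) κ x`. -/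
theorem pairing_of_kernel_succ (P : Finset (Bond (d + 1))) (θ s : ℝ) (κ : Fin (d + 1)) (x : Site (d + 1))
    (vh : Bond (d + 1) → Bond (d + 1) → ℝ) (hvh : ∀ g g', g ∉ P ∨ g' ∉ P → vh g g' = 0)
    (a : Bond (d + 1) → ℝ) (ha : ∀ g ∉ P, a g = 0)
    (Af : Form1 (d + 1) ℝ → Form1 (d + 1) ℝ) (hAf : ∀ F : Form1 (d + 1) ℝ, Af F κ x = ∑' x₁ : Site (d + 1), ∑ κ₁ : Fin (d + 1), a (κ₁, x₁) * F κ₁ x₁)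
    (c : Bond (d + 1) → Bond (d + 1) → ℝ) (Sc : Bond (d + 1) → Finset (Site (d + 1))) (hc : ∀ g (m : Fin (d + 1)), ∀ w ∉ Sc g, c g (m, w) = 0)
    (Cf : Form1 (d + 1) ℝ → Form1 (d + 1) ℝ) (hCf : ∀ (B : Form1 (d + 1) ℝ) (g : Bond (d + 1)), Cf B g.1 g.2 = ∑' w : Site (d + 1), ∑ m : Fin (d + 1), c g (m, w) * B m w)
    (𝒦 : Bond (d + 1) → Bond (d + 1) → Bond (d + 1) → ℝ) (SK : Bond (d + 1) → Finset (Site (d + 1)))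
    (hKz : ∀ g (l : Fin (d + 1)) (f' : Bond (d + 1)), ∀ z ∉ SK g, 𝒦 g (l, z) f' = 0)
    (hKu : ∀ g (f : Bond (d + 1)) (κ' : Fin (d + 1)), ∀ u ∉ SK g, 𝒦 g f (κ', u) = 0)
    (ℐ : Form1 (d + 1) ℝ → Form1 (d + 1) ℝ → Form1 (d + 1) ℝ)
    (hℐ : ∀ (H B : Form1 (d + 1) ℝ) (g : Bond (d + 1)), ℐ H B g.1 g.2
      = ∑' u : Site (d + 1), ∑ κ' : Fin (d + 1), (∑' z : Site (d + 1), ∑ l : Fin (d + 1), 𝒦 g (l, z) (κ', u) * B l z) * H κ' u)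
    (𝒦' : Bond (d + 1) → Bond (d + 1) → ℝ)
    (h𝒦' : ∀ f f' : Bond (d + 1), 𝒦' f f' = θ * (∑ g ∈ P, ∑ g' ∈ P, vh g g' * c g f * c g' f') + s * ∑ g ∈ P, a g * 𝒦 g f f')
    (B H : Form1 (d + 1) ℝ) :
    (∑' u : Site (d + 1), ∑ κ' : Fin (d + 1), (∑' z : Site (d + 1), ∑ l : Fin (d + 1), 𝒦' (l, z) (κ', u) * B l z) * H κ' u)
      = θ * (∑' u₁ : Site (d + 1), ∑ κ₁ : Fin (d + 1), (∑' z₁ : Site (d + 1), ∑ l₁ : Fin (d + 1), vh (l₁, z₁) (κ₁, u₁) * Cf B l₁ z₁) * Cf H κ₁ u₁)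
        + s * Af (ℐ H B) κ x := by
  classical
  -- (1) split the kernel: `𝒦′ = Σ_{(g,g′) ∈ P × P} (θ·vh g g′ · c g′ f′) · c g f + Σ_{g ∈ P} (s · a g) · 𝒦 g f f′` as ONE finite combination in the field bond `f`
  have hsplit : ∀ (κ' : Fin (d + 1)) (u : Site (d + 1)) (l : Fin (d + 1)) (z : Site (d + 1)), 𝒦' (l, z) (κ', u)
      = ∑ i ∈ (P ×ˢ P).disjSum P, Sum.elim (fun q : Bond (d + 1) × Bond (d + 1) => θ * vh q.1 q.2 * c q.2 (κ', u)) (fun g => s * a g) i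
          * Sum.elim (fun q : Bond (d + 1) × Bond (d + 1) => fun (l : Fin (d + 1)) (z : Site (d + 1)) => c q.1 (l, z))
              (fun g => fun (l : Fin (d + 1)) (z : Site (d + 1)) => 𝒦 g (l, z) (κ', u)) i l z := fun κ' u l z => by
    rw [h𝒦', Finset.sum_disjSum, Finset.sum_product]
    simp only [Sum.elim_inl, Sum.elim_inr, Finset.mul_sum]
    congr 1
    · exact Finset.sum_congr rfl fun g _ => Finset.sum_congr rfl fun g' _ => by ring
    · exact Finset.sum_congr rfl fun g _ => by ring
  -- (2) the inner pairing (field bond) through the plumbing lemma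
  have hin : ∀ (κ' : Fin (d + 1)) (u : Site (d + 1)),
      (∑' z : Site (d + 1), ∑ l : Fin (d + 1), 𝒦' (l, z) (κ', u) * B l z)
        = (∑ q ∈ P ×ˢ P, (θ * vh q.1 q.2 * c q.2 (κ', u)) * ∑' z : Site (d + 1), ∑ l : Fin (d + 1), c q.1 (l, z) * B l z)
          + ∑ g ∈ P, (s * a g) * ∑' z : Site (d + 1), ∑ l : Fin (d + 1), 𝒦 g (l, z) (κ', u) * B l z := fun κ' u => by
    rw [tsum_congr fun z => Finset.sum_congr rfl fun l _ => by rw [hsplit κ' u l z]]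
    rw [tsum_sum_finset_mul_eq ((P ×ˢ P).disjSum P) _ _
      (Sum.elim (fun q : Bond (d + 1) × Bond (d + 1) => Sc q.1) (fun g => SK g)) (fun i l z hz => ?_) B]
    · rw [Finset.sum_disjSum]
      rfl
    · cases i with
      | inl q => exact hc q.1 l z hz
      | inr g => exact hKz g l (κ', u) z hz
  -- (3) the outer pairing (background bond): again ONE finite combination, now in `(κ′, u)`
  have hout : ∀ (κ' : Fin (d + 1)) (u : Site (d + 1)),
      (∑' z : Site (d + 1), ∑ l : Fin (d + 1), 𝒦' (l, z) (κ', u) * B l z)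
        = ∑ i ∈ (P ×ˢ P).disjSum P,
            Sum.elim (fun q : Bond (d + 1) × Bond (d + 1) => θ * vh q.1 q.2 * ∑' z : Site (d + 1), ∑ l : Fin (d + 1), c q.1 (l, z) * B l z) (fun g => s * a g) i
            * Sum.elim (fun q : Bond (d + 1) × Bond (d + 1) => fun (κ' : Fin (d + 1)) (u : Site (d + 1)) => c q.2 (κ', u))
                (fun g => fun (κ' : Fin (d + 1)) (u : Site (d + 1)) => ∑' z : Site (d + 1), ∑ l : Fin (d + 1), 𝒦 g (l, z) (κ', u) * B l z) i κ' u := fun κ' u => by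
    rw [hin, Finset.sum_disjSum]
    simp only [Sum.elim_inl, Sum.elim_inr]
    congr 1
    exact Finset.sum_congr rfl fun q _ => by ring
  rw [tsum_congr fun u => Finset.sum_congr rfl fun κ' _ => by rw [hout κ' u]]
  rw [tsum_sum_finset_mul_eq ((P ×ˢ P).disjSum P) _ _ (Sum.elim (fun q : Bond (d + 1) × Bond (d + 1) => Sc q.2) (fun g => SK g)) (fun i κ' u hu => ?_) H]
  · -- (4) read the two halves as `θ · (…)` and `s · Af (ℐ H B) κ x`
    rw [Finset.sum_disjSum]
    simp only [Sum.elim_inl, Sum.elim_inr]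
    congr 1
    · -- the `vh` half: back from `P × P` to the bond `tsum`s, reading `Cf`
      have hF : ∀ g' : Bond (d + 1), g' ∉ P → (fun g' : Bond (d + 1) =>
          (∑' z₁ : Site (d + 1), ∑ l₁ : Fin (d + 1), vh (l₁, z₁) g' * Cf B l₁ z₁) * Cf H g'.1 g'.2) g' = 0 := fun g' hg' => by
        simp only [hvh _ g' (Or.inr hg'), zero_mul, Finset.sum_const_zero, tsum_zero]
      have hG : ∀ (g' : Bond (d + 1)) (g : Bond (d + 1)), g ∉ P → (fun g : Bond (d + 1) => vh g g' * Cf B g.1 g.2) g = 0 := fun g' g hg => by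
        simp only [hvh g g' (Or.inl hg), zero_mul]
      rw [show (∑' u₁ : Site (d + 1), ∑ κ₁ : Fin (d + 1), (∑' z₁ : Site (d + 1), ∑ l₁ : Fin (d + 1), vh (l₁, z₁) (κ₁, u₁) * Cf B l₁ z₁) * Cf H κ₁ u₁)
          = ∑ g' ∈ P, (∑' z₁ : Site (d + 1), ∑ l₁ : Fin (d + 1), vh (l₁, z₁) g' * Cf B l₁ z₁) * Cf H g'.1 g'.2 from tsum_sum_eq_finset_sum P _ hF,
        Finset.mul_sum, Finset.sum_product_right]
      refine Finset.sum_congr rfl fun g' hg' => ?_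
      rw [show (∑' z₁ : Site (d + 1), ∑ l₁ : Fin (d + 1), vh (l₁, z₁) g' * Cf B l₁ z₁) = ∑ g ∈ P, vh g g' * Cf B g.1 g.2 from tsum_sum_eq_finset_sum P _ (hG g'),
        hCf H g', Finset.sum_mul, Finset.mul_sum]
      exact Finset.sum_congr rfl fun g _ => by rw [hCf B g]; ring
    · -- the `a` half: `s · Af (ℐ H B) κ x`
      rw [hAf]
      have hF : ∀ g : Bond (d + 1), g ∉ P → (fun g : Bond (d + 1) => a g * ℐ H B g.1 g.2) g = 0 := fun g hg => by
        simp only [ha g hg, zero_mul]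
      rw [show (∑' x₁ : Site (d + 1), ∑ κ₁ : Fin (d + 1), a (κ₁, x₁) * ℐ H B κ₁ x₁) = ∑ g ∈ P, a g * ℐ H B g.1 g.2 from tsum_sum_eq_finset_sum P _ hF,
        Finset.mul_sum]
      exact Finset.sum_congr rfl fun g _ => by rw [hℐ H B g]; ring
  · cases i with
    | inl q => exact hc q.2 κ' u hu
    | inr g => refine (tsum_congr fun z => ?_).trans tsum_zero; exact Finset.sum_eq_zero fun l _ => by rw [hKu g (l, z) κ' u hu, zero_mul]


/-! ## §3 Order 2: bi-kernel recursion ⇒ bi-functional recursion (R-8's `hsucc₂`) -/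

/-- [folklore] **`pairing₂_of_kernel_succ` — BI-KERNEL RECURSION ⇒ BI-FUNCTIONAL RECURSION (the lattice half of F5, presentation-agnostic).**  Beyond §2's data:
the top one-step SECOND mixed kernel `vh2 g g₁ g₂` (field bond, first and second background bonds; supported in `P³`: `hvh2`), the lower two-bond border
kernels `𝒲 g f f₁ f₂` with bi-functionals `ℐ₂` (`hℐ₂`, R-10's nesting: first background bond OUTER; windows `hWz hW₁ hW₂`), the lower order-1 kernels `𝒦 g`
with `ℐ₁` as in §2, and the upper two-bond kernel `𝒲′` obeying the TOP-PEELED RECURSION `h𝒲′` (the four summands of OUR second chain rule: `θ₂·vh2·c⊗c⊗c`,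
`θ·vh·(𝒦⊗c)` twice, `s·a·𝒲`).  Conclusion: the two-bond border pairing of `𝒲′` against `(B, H′, H)` IS R-8's successor clause `hsucc₂`. -/
theorem pairing₂_of_kernel_succ (P : Finset (Bond (d + 1))) (θ₂ θ s : ℝ) (κ : Fin (d + 1)) (x : Site (d + 1))
    (vh : Bond (d + 1) → Bond (d + 1) → ℝ) (hvh : ∀ g g', g ∉ P ∨ g' ∉ P → vh g g' = 0)
    (vh2 : Bond (d + 1) → Bond (d + 1) → Bond (d + 1) → ℝ) (hvh2 : ∀ g g₁ g₂, g ∉ P ∨ g₁ ∉ P ∨ g₂ ∉ P → vh2 g g₁ g₂ = 0)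
    (a : Bond (d + 1) → ℝ) (ha : ∀ g ∉ P, a g = 0)
    (Af : Form1 (d + 1) ℝ → Form1 (d + 1) ℝ) (hAf : ∀ F : Form1 (d + 1) ℝ, Af F κ x = ∑' x₁ : Site (d + 1), ∑ κ₁ : Fin (d + 1), a (κ₁, x₁) * F κ₁ x₁)
    (c : Bond (d + 1) → Bond (d + 1) → ℝ) (Sc : Bond (d + 1) → Finset (Site (d + 1))) (hc : ∀ g (m : Fin (d + 1)), ∀ w ∉ Sc g, c g (m, w) = 0)
    (Cf : Form1 (d + 1) ℝ → Form1 (d + 1) ℝ) (hCf : ∀ (B : Form1 (d + 1) ℝ) (g : Bond (d + 1)), Cf B g.1 g.2 = ∑' w : Site (d + 1), ∑ m : Fin (d + 1), c g (m, w) * B m w)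
    (𝒦 : Bond (d + 1) → Bond (d + 1) → Bond (d + 1) → ℝ) (SK : Bond (d + 1) → Finset (Site (d + 1)))
    (hKz : ∀ g (l : Fin (d + 1)) (f' : Bond (d + 1)), ∀ z ∉ SK g, 𝒦 g (l, z) f' = 0)
    (hKu : ∀ g (f : Bond (d + 1)) (κ' : Fin (d + 1)), ∀ u ∉ SK g, 𝒦 g f (κ', u) = 0)
    (ℐ₁ : Form1 (d + 1) ℝ → Form1 (d + 1) ℝ → Form1 (d + 1) ℝ)
    (hℐ₁ : ∀ (H B : Form1 (d + 1) ℝ) (g : Bond (d + 1)), ℐ₁ H B g.1 g.2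
      = ∑' u : Site (d + 1), ∑ κ' : Fin (d + 1), (∑' z : Site (d + 1), ∑ l : Fin (d + 1), 𝒦 g (l, z) (κ', u) * B l z) * H κ' u)
    (𝒲 : Bond (d + 1) → Bond (d + 1) → Bond (d + 1) → Bond (d + 1) → ℝ) (SW : Bond (d + 1) → Finset (Site (d + 1)))
    (hWz : ∀ g (l : Fin (d + 1)) (f₁ f₂ : Bond (d + 1)), ∀ z ∉ SW g, 𝒲 g (l, z) f₁ f₂ = 0)
    (hW₁ : ∀ g (f : Bond (d + 1)) (κ₁ : Fin (d + 1)) (f₂ : Bond (d + 1)), ∀ u ∉ SW g, 𝒲 g f (κ₁, u) f₂ = 0)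
    (hW₂ : ∀ g (f f₁ : Bond (d + 1)) (κ₂ : Fin (d + 1)), ∀ u ∉ SW g, 𝒲 g f f₁ (κ₂, u) = 0)
    (ℐ₂ : Form1 (d + 1) ℝ → Form1 (d + 1) ℝ → Form1 (d + 1) ℝ → Form1 (d + 1) ℝ)
    (hℐ₂ : ∀ (H H' B : Form1 (d + 1) ℝ) (g : Bond (d + 1)), ℐ₂ H H' B g.1 g.2
      = ∑' u : Site (d + 1), ∑ κ₁ : Fin (d + 1), (∑' u' : Site (d + 1), ∑ κ₂ : Fin (d + 1),
          (∑' z : Site (d + 1), ∑ l : Fin (d + 1), 𝒲 g (l, z) (κ₁, u) (κ₂, u') * B l z) * H' κ₂ u') * H κ₁ u)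
    (𝒲' : Bond (d + 1) → Bond (d + 1) → Bond (d + 1) → ℝ)
    (h𝒲' : ∀ f f₁ f₂ : Bond (d + 1), 𝒲' f f₁ f₂
      = θ₂ * (∑ g ∈ P, ∑ g₁ ∈ P, ∑ g₂ ∈ P, vh2 g g₁ g₂ * c g f * c g₁ f₁ * c g₂ f₂)
        + θ * ((∑ g ∈ P, ∑ g₁ ∈ P, vh g g₁ * 𝒦 g f f₂ * c g₁ f₁) + (∑ g ∈ P, ∑ g₂ ∈ P, vh g g₂ * 𝒦 g f f₁ * c g₂ f₂))
        + s * ∑ g ∈ P, a g * 𝒲 g f f₁ f₂)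
    (B H' H : Form1 (d + 1) ℝ) :
    (∑' u : Site (d + 1), ∑ κ₁ : Fin (d + 1), (∑' u' : Site (d + 1), ∑ κ₂ : Fin (d + 1),
        (∑' z : Site (d + 1), ∑ l : Fin (d + 1), 𝒲' (l, z) (κ₁, u) (κ₂, u') * B l z) * H' κ₂ u') * H κ₁ u)
      = θ₂ * (∑' u : Site (d + 1), ∑ κ₁ : Fin (d + 1), (∑' u' : Site (d + 1), ∑ κ₂ : Fin (d + 1),
            (∑' z : Site (d + 1), ∑ l : Fin (d + 1), vh2 (l, z) (κ₁, u) (κ₂, u') * Cf B l z) * Cf H' κ₂ u') * Cf H κ₁ u)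
        + θ * ((∑' u : Site (d + 1), ∑ κ' : Fin (d + 1), (∑' z : Site (d + 1), ∑ l : Fin (d + 1), vh (l, z) (κ', u) * ℐ₁ H' B l z) * Cf H κ' u)
          + (∑' u : Site (d + 1), ∑ κ' : Fin (d + 1), (∑' z : Site (d + 1), ∑ l : Fin (d + 1), vh (l, z) (κ', u) * ℐ₁ H B l z) * Cf H' κ' u))
        + s * Af (ℐ₂ H H' B) κ x := by
  classical
  -- index set of the four summands: `(g,(g₁,g₂))`, `(g,g₁)`, `(g,g₂)`, `g`
  set I : Finset (((Bond (d + 1) × (Bond (d + 1) × Bond (d + 1))) ⊕ (Bond (d + 1) × Bond (d + 1))) ⊕ ((Bond (d + 1) × Bond (d + 1)) ⊕ Bond (d + 1))) :=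
    ((P ×ˢ (P ×ˢ P)).disjSum (P ×ˢ P)).disjSum ((P ×ˢ P).disjSum P) with hI
  -- abbreviations for the lower pairings
  set KB : Bond (d + 1) → Bond (d + 1) → ℝ := fun g f' => ∑' z : Site (d + 1), ∑ l : Fin (d + 1), 𝒦 g (l, z) f' * B l z with hKB
  set WB : Bond (d + 1) → Bond (d + 1) → Bond (d + 1) → ℝ := fun g f₁ f₂ => ∑' z : Site (d + 1), ∑ l : Fin (d + 1), 𝒲 g (l, z) f₁ f₂ * B l z
  set CB : Bond (d + 1) → ℝ := fun g => ∑' z : Site (d + 1), ∑ l : Fin (d + 1), c g (l, z) * B l z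
  set CH' : Bond (d + 1) → ℝ := fun g => ∑' u : Site (d + 1), ∑ m : Fin (d + 1), c g (m, u) * H' m u
  set WBH' : Bond (d + 1) → Bond (d + 1) → ℝ := fun g f₁ => ∑' u' : Site (d + 1), ∑ κ₂ : Fin (d + 1), WB g f₁ (κ₂, u') * H' κ₂ u'
  -- LEVEL 1 (field bond): `𝒲′ (·) f₁ f₂` as ONE finite combination
  have hsplit₁ : ∀ (κ₁ : Fin (d + 1)) (u : Site (d + 1)) (κ₂ : Fin (d + 1)) (u' : Site (d + 1)) (l : Fin (d + 1)) (z : Site (d + 1)),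
      𝒲' (l, z) (κ₁, u) (κ₂, u') = ∑ i ∈ I,
        Sum.elim (Sum.elim (fun q : Bond (d + 1) × (Bond (d + 1) × Bond (d + 1)) => θ₂ * vh2 q.1 q.2.1 q.2.2 * c q.2.1 (κ₁, u) * c q.2.2 (κ₂, u'))
            (fun q : Bond (d + 1) × Bond (d + 1) => θ * vh q.1 q.2 * c q.2 (κ₁, u)))
          (Sum.elim (fun q : Bond (d + 1) × Bond (d + 1) => θ * vh q.1 q.2 * c q.2 (κ₂, u')) (fun g => s * a g)) i
        * Sum.elim (Sum.elim (fun q : Bond (d + 1) × (Bond (d + 1) × Bond (d + 1)) => fun (l : Fin (d + 1)) (z : Site (d + 1)) => c q.1 (l, z))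
            (fun q : Bond (d + 1) × Bond (d + 1) => fun (l : Fin (d + 1)) (z : Site (d + 1)) => 𝒦 q.1 (l, z) (κ₂, u')))
          (Sum.elim (fun q : Bond (d + 1) × Bond (d + 1) => fun (l : Fin (d + 1)) (z : Site (d + 1)) => 𝒦 q.1 (l, z) (κ₁, u))
            (fun g => fun (l : Fin (d + 1)) (z : Site (d + 1)) => 𝒲 g (l, z) (κ₁, u) (κ₂, u'))) i l z := fun κ₁ u κ₂ u' l z => by
    rw [h𝒲', hI, Finset.sum_disjSum, Finset.sum_disjSum, Finset.sum_disjSum]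
    simp only [Sum.elim_inl, Sum.elim_inr, Finset.sum_product, Finset.mul_sum, mul_add, add_assoc]
    refine congrArg₂ (· + ·) ?_ (congrArg₂ (· + ·) ?_ (congrArg₂ (· + ·) ?_ ?_))
    · exact Finset.sum_congr rfl fun g _ => Finset.sum_congr rfl fun g₁ _ => Finset.sum_congr rfl fun g₂ _ => by ring
    · exact Finset.sum_congr rfl fun g _ => Finset.sum_congr rfl fun g₁ _ => by ring
    · exact Finset.sum_congr rfl fun g _ => Finset.sum_congr rfl fun g₂ _ => by ring
    · exact Finset.sum_congr rfl fun g _ => by ring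
  have hlev₁ : ∀ (κ₁ : Fin (d + 1)) (u : Site (d + 1)) (κ₂ : Fin (d + 1)) (u' : Site (d + 1)),
      (∑' z : Site (d + 1), ∑ l : Fin (d + 1), 𝒲' (l, z) (κ₁, u) (κ₂, u') * B l z) = ∑ i ∈ I,
        Sum.elim (Sum.elim (fun q : Bond (d + 1) × (Bond (d + 1) × Bond (d + 1)) => θ₂ * vh2 q.1 q.2.1 q.2.2 * c q.2.1 (κ₁, u) * c q.2.2 (κ₂, u'))
            (fun q : Bond (d + 1) × Bond (d + 1) => θ * vh q.1 q.2 * c q.2 (κ₁, u)))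
          (Sum.elim (fun q : Bond (d + 1) × Bond (d + 1) => θ * vh q.1 q.2 * c q.2 (κ₂, u')) (fun g => s * a g)) i
        * Sum.elim (Sum.elim (fun q : Bond (d + 1) × (Bond (d + 1) × Bond (d + 1)) => CB q.1) (fun q : Bond (d + 1) × Bond (d + 1) => KB q.1 (κ₂, u')))
          (Sum.elim (fun q : Bond (d + 1) × Bond (d + 1) => KB q.1 (κ₁, u)) (fun g => WB g (κ₁, u) (κ₂, u'))) i := fun κ₁ u κ₂ u' => by
    rw [tsum_congr fun z => Finset.sum_congr rfl fun l _ => by rw [hsplit₁ κ₁ u κ₂ u' l z]]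
    rw [tsum_sum_finset_mul_eq I _ _ (Sum.elim (Sum.elim (fun q => Sc q.1) (fun q => SK q.1)) (Sum.elim (fun q => SK q.1) (fun g => SW g)))
      (fun i l z hz => ?_) B]
    · refine Finset.sum_congr rfl fun i _ => ?_
      rcases i with (q | q) | (q | g) <;> rfl
    · rcases i with (q | q) | (q | g)
      · exact hc q.1 l z hz
      · exact hKz q.1 l _ z hz
      · exact hKz q.1 l _ z hz
      · exact hWz g l _ _ z hz
  have hlev₂ : ∀ (κ₁ : Fin (d + 1)) (u : Site (d + 1)),
      (∑' u' : Site (d + 1), ∑ κ₂ : Fin (d + 1), (∑' z : Site (d + 1), ∑ l : Fin (d + 1), 𝒲' (l, z) (κ₁, u) (κ₂, u') * B l z) * H' κ₂ u') = ∑ i ∈ I,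
        Sum.elim (Sum.elim (fun q : Bond (d + 1) × (Bond (d + 1) × Bond (d + 1)) => θ₂ * vh2 q.1 q.2.1 q.2.2 * c q.2.1 (κ₁, u) * CB q.1)
            (fun q : Bond (d + 1) × Bond (d + 1) => θ * vh q.1 q.2 * c q.2 (κ₁, u)))
          (Sum.elim (fun q : Bond (d + 1) × Bond (d + 1) => θ * vh q.1 q.2 * KB q.1 (κ₁, u)) (fun g => s * a g)) i
        * Sum.elim (Sum.elim (fun q : Bond (d + 1) × (Bond (d + 1) × Bond (d + 1)) => CH' q.2.2) (fun q : Bond (d + 1) × Bond (d + 1) => ℐ₁ H' B q.1.1 q.1.2))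
          (Sum.elim (fun q : Bond (d + 1) × Bond (d + 1) => CH' q.2) (fun g => WBH' g (κ₁, u))) i := fun κ₁ u => by
    have hre : ∀ (κ₂ : Fin (d + 1)) (u' : Site (d + 1)),
        (∑' z : Site (d + 1), ∑ l : Fin (d + 1), 𝒲' (l, z) (κ₁, u) (κ₂, u') * B l z) = ∑ i ∈ I,
          Sum.elim (Sum.elim (fun q : Bond (d + 1) × (Bond (d + 1) × Bond (d + 1)) => θ₂ * vh2 q.1 q.2.1 q.2.2 * c q.2.1 (κ₁, u) * CB q.1)
              (fun q : Bond (d + 1) × Bond (d + 1) => θ * vh q.1 q.2 * c q.2 (κ₁, u)))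
            (Sum.elim (fun q : Bond (d + 1) × Bond (d + 1) => θ * vh q.1 q.2 * KB q.1 (κ₁, u)) (fun g => s * a g)) i
          * Sum.elim (Sum.elim (fun q : Bond (d + 1) × (Bond (d + 1) × Bond (d + 1)) => fun (κ₂ : Fin (d + 1)) (u' : Site (d + 1)) => c q.2.2 (κ₂, u'))
              (fun q : Bond (d + 1) × Bond (d + 1) => fun (κ₂ : Fin (d + 1)) (u' : Site (d + 1)) => KB q.1 (κ₂, u')))
            (Sum.elim (fun q : Bond (d + 1) × Bond (d + 1) => fun (κ₂ : Fin (d + 1)) (u' : Site (d + 1)) => c q.2 (κ₂, u'))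
              (fun g => fun (κ₂ : Fin (d + 1)) (u' : Site (d + 1)) => WB g (κ₁, u) (κ₂, u'))) i κ₂ u' := fun κ₂ u' => by
      rw [hlev₁]
      refine Finset.sum_congr rfl fun i _ => ?_
      rcases i with (q | q) | (q | g)
      · simp only [Sum.elim_inl]; ring
      · simp only [Sum.elim_inl, Sum.elim_inr]
      · simp only [Sum.elim_inl, Sum.elim_inr]; ring
      · simp only [Sum.elim_inr]
    rw [tsum_congr fun u' => Finset.sum_congr rfl fun κ₂ _ => by rw [hre κ₂ u']]
    rw [tsum_sum_finset_mul_eq I _ _ (Sum.elim (Sum.elim (fun q => Sc q.2.2) (fun q => SK q.1)) (Sum.elim (fun q => Sc q.2) (fun g => SW g)))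
      (fun i κ₂ u' hu' => ?_) H']
    · refine Finset.sum_congr rfl fun i _ => ?_
      rcases i with (q | q) | (q | g)
      · rfl
      · simp only [Sum.elim_inl, Sum.elim_inr, hℐ₁ H' B q.1, hKB]
      · rfl
      · rfl
    · rcases i with (q | q) | (q | g)
      · exact hc q.2.2 κ₂ u' hu'
      · show (∑' z : Site (d + 1), ∑ l : Fin (d + 1), 𝒦 q.1 (l, z) (κ₂, u') * B l z) = 0
        exact (tsum_congr fun z => Finset.sum_eq_zero fun l _ => by rw [hKu q.1 (l, z) κ₂ u' hu', zero_mul]).trans tsum_zero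
      · exact hc q.2 κ₂ u' hu'
      · show (∑' z : Site (d + 1), ∑ l : Fin (d + 1), 𝒲 g (l, z) (κ₁, u) (κ₂, u') * B l z) = 0
        exact (tsum_congr fun z => Finset.sum_eq_zero fun l _ => by rw [hW₂ g (l, z) _ κ₂ u' hu', zero_mul]).trans tsum_zero
  have hre₃ : ∀ (κ₁ : Fin (d + 1)) (u : Site (d + 1)),
      (∑' u' : Site (d + 1), ∑ κ₂ : Fin (d + 1), (∑' z : Site (d + 1), ∑ l : Fin (d + 1), 𝒲' (l, z) (κ₁, u) (κ₂, u') * B l z) * H' κ₂ u') = ∑ i ∈ I,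
        Sum.elim (Sum.elim (fun q : Bond (d + 1) × (Bond (d + 1) × Bond (d + 1)) => θ₂ * vh2 q.1 q.2.1 q.2.2 * CB q.1 * CH' q.2.2)
            (fun q : Bond (d + 1) × Bond (d + 1) => θ * vh q.1 q.2 * ℐ₁ H' B q.1.1 q.1.2))
          (Sum.elim (fun q : Bond (d + 1) × Bond (d + 1) => θ * vh q.1 q.2 * CH' q.2) (fun g => s * a g)) i
        * Sum.elim (Sum.elim (fun q : Bond (d + 1) × (Bond (d + 1) × Bond (d + 1)) => fun (κ₁ : Fin (d + 1)) (u : Site (d + 1)) => c q.2.1 (κ₁, u))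
            (fun q : Bond (d + 1) × Bond (d + 1) => fun (κ₁ : Fin (d + 1)) (u : Site (d + 1)) => c q.2 (κ₁, u)))
          (Sum.elim (fun q : Bond (d + 1) × Bond (d + 1) => fun (κ₁ : Fin (d + 1)) (u : Site (d + 1)) => KB q.1 (κ₁, u))
            (fun g => fun (κ₁ : Fin (d + 1)) (u : Site (d + 1)) => WBH' g (κ₁, u))) i κ₁ u := fun κ₁ u => by
    rw [hlev₂]
    refine Finset.sum_congr rfl fun i _ => ?_
    rcases i with (q | q) | (q | g)
    · simp only [Sum.elim_inl]; ring
    · simp only [Sum.elim_inl, Sum.elim_inr]; ring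
    · simp only [Sum.elim_inl, Sum.elim_inr]; ring
    · simp only [Sum.elim_inr]
  rw [tsum_congr fun u => Finset.sum_congr rfl fun κ₁ _ => by rw [hre₃ κ₁ u]]
  rw [tsum_sum_finset_mul_eq I _ _ (Sum.elim (Sum.elim (fun q => Sc q.2.1) (fun q => Sc q.2)) (Sum.elim (fun q => SK q.1) (fun g => SW g)))
    (fun i κ₁ u hu => ?_) H]
  · -- read the four components
    rw [hI, Finset.sum_disjSum, Finset.sum_disjSum, Finset.sum_disjSum]
    simp only [Sum.elim_inl, Sum.elim_inr]
    -- the lower pairings by name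
    have eCB : ∀ g : Bond (d + 1), CB g = Cf B g.1 g.2 := fun g => by rw [hCf B g]
    have eCH' : ∀ g : Bond (d + 1), CH' g = Cf H' g.1 g.2 := fun g => by rw [hCf H' g]
    have eCH : ∀ g : Bond (d + 1), (∑' u : Site (d + 1), ∑ m : Fin (d + 1), c g (m, u) * H m u) = Cf H g.1 g.2 := fun g => by rw [hCf H g]
    have eKB : ∀ g : Bond (d + 1), (∑' u : Site (d + 1), ∑ κ₁ : Fin (d + 1), KB g (κ₁, u) * H κ₁ u) = ℐ₁ H B g.1 g.2 := fun g => by rw [hℐ₁ H B g]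
    have eWBH' : ∀ g : Bond (d + 1), (∑' u : Site (d + 1), ∑ κ₁ : Fin (d + 1), WBH' g (κ₁, u) * H κ₁ u) = ℐ₂ H H' B g.1 g.2 := fun g => by rw [hℐ₂ H H' B g]
    -- (A) the `vh2` component
    have eA : (∑ q ∈ P ×ˢ (P ×ˢ P), θ₂ * vh2 q.1 q.2.1 q.2.2 * CB q.1 * CH' q.2.2 * ∑' u : Site (d + 1), ∑ m : Fin (d + 1), c q.2.1 (m, u) * H m u)
        = θ₂ * (∑' u : Site (d + 1), ∑ κ₁ : Fin (d + 1), (∑' u' : Site (d + 1), ∑ κ₂ : Fin (d + 1),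
            (∑' z : Site (d + 1), ∑ l : Fin (d + 1), vh2 (l, z) (κ₁, u) (κ₂, u') * Cf B l z) * Cf H' κ₂ u') * Cf H κ₁ u) := by
      have e1 : ∀ g₁ g₂ : Bond (d + 1), (∑' z : Site (d + 1), ∑ l : Fin (d + 1), vh2 (l, z) g₁ g₂ * Cf B l z) = ∑ g ∈ P, vh2 g g₁ g₂ * Cf B g.1 g.2 :=
        fun g₁ g₂ => tsum_sum_eq_finset_sum P (fun g => vh2 g g₁ g₂ * Cf B g.1 g.2) fun g hg => by simp only [hvh2 g g₁ g₂ (Or.inl hg), zero_mul]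
      have e2 : ∀ g₁ : Bond (d + 1), (∑' u' : Site (d + 1), ∑ κ₂ : Fin (d + 1), (∑' z : Site (d + 1), ∑ l : Fin (d + 1), vh2 (l, z) g₁ (κ₂, u') * Cf B l z) * Cf H' κ₂ u')
          = ∑ g₂ ∈ P, (∑ g ∈ P, vh2 g g₁ g₂ * Cf B g.1 g.2) * Cf H' g₂.1 g₂.2 := fun g₁ => by
        rw [tsum_congr fun u' => Finset.sum_congr rfl fun κ₂ _ => by rw [e1]]
        exact tsum_sum_eq_finset_sum P (fun g₂ => (∑ g ∈ P, vh2 g g₁ g₂ * Cf B g.1 g.2) * Cf H' g₂.1 g₂.2) fun g₂ hg₂ => by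
          rw [Finset.sum_eq_zero fun g _ => by rw [hvh2 _ g₁ g₂ (Or.inr (Or.inr hg₂)), zero_mul], zero_mul]
      have e3 : (∑' u : Site (d + 1), ∑ κ₁ : Fin (d + 1), (∑' u' : Site (d + 1), ∑ κ₂ : Fin (d + 1),
            (∑' z : Site (d + 1), ∑ l : Fin (d + 1), vh2 (l, z) (κ₁, u) (κ₂, u') * Cf B l z) * Cf H' κ₂ u') * Cf H κ₁ u)
          = ∑ g₁ ∈ P, (∑ g₂ ∈ P, (∑ g ∈ P, vh2 g g₁ g₂ * Cf B g.1 g.2) * Cf H' g₂.1 g₂.2) * Cf H g₁.1 g₁.2 := by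
        rw [tsum_congr fun u => Finset.sum_congr rfl fun κ₁ _ => by rw [e2]]
        exact tsum_sum_eq_finset_sum P (fun g₁ => (∑ g₂ ∈ P, (∑ g ∈ P, vh2 g g₁ g₂ * Cf B g.1 g.2) * Cf H' g₂.1 g₂.2) * Cf H g₁.1 g₁.2) fun g₁ hg₁ => by
          rw [Finset.sum_eq_zero fun g₂ _ => by rw [Finset.sum_eq_zero fun g _ => by rw [hvh2 _ g₁ _ (Or.inr (Or.inl hg₁)), zero_mul], zero_mul], zero_mul]
      calc (∑ q ∈ P ×ˢ (P ×ˢ P), θ₂ * vh2 q.1 q.2.1 q.2.2 * CB q.1 * CH' q.2.2 * ∑' u : Site (d + 1), ∑ m : Fin (d + 1), c q.2.1 (m, u) * H m u)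
          = ∑ g ∈ P, ∑ g₁ ∈ P, ∑ g₂ ∈ P, θ₂ * vh2 g g₁ g₂ * Cf B g.1 g.2 * Cf H' g₂.1 g₂.2 * Cf H g₁.1 g₁.2 := by
            rw [Finset.sum_product]
            refine Finset.sum_congr rfl fun g _ => ?_
            rw [Finset.sum_product]
            exact Finset.sum_congr rfl fun g₁ _ => Finset.sum_congr rfl fun g₂ _ => by rw [eCB, eCH', eCH]
        _ = ∑ g₁ ∈ P, ∑ g₂ ∈ P, ∑ g ∈ P, θ₂ * vh2 g g₁ g₂ * Cf B g.1 g.2 * Cf H' g₂.1 g₂.2 * Cf H g₁.1 g₁.2 := by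
            rw [Finset.sum_comm]
            exact Finset.sum_congr rfl fun g₁ _ => Finset.sum_comm
        _ = θ₂ * (∑' u : Site (d + 1), ∑ κ₁ : Fin (d + 1), (∑' u' : Site (d + 1), ∑ κ₂ : Fin (d + 1),
            (∑' z : Site (d + 1), ∑ l : Fin (d + 1), vh2 (l, z) (κ₁, u) (κ₂, u') * Cf B l z) * Cf H' κ₂ u') * Cf H κ₁ u) := by
            rw [e3, Finset.mul_sum]
            refine Finset.sum_congr rfl fun g₁ _ => ?_
            rw [Finset.sum_mul, Finset.mul_sum]
            refine Finset.sum_congr rfl fun g₂ _ => ?_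
            rw [Finset.sum_mul, Finset.sum_mul, Finset.mul_sum]
            exact Finset.sum_congr rfl fun g _ => by ring
    -- (B) the first mixed component
    have eB : (∑ q ∈ P ×ˢ P, θ * vh q.1 q.2 * ℐ₁ H' B q.1.1 q.1.2 * ∑' u : Site (d + 1), ∑ m : Fin (d + 1), c q.2 (m, u) * H m u)
        = θ * (∑' u : Site (d + 1), ∑ κ' : Fin (d + 1), (∑' z : Site (d + 1), ∑ l : Fin (d + 1), vh (l, z) (κ', u) * ℐ₁ H' B l z) * Cf H κ' u) := by
      have e1 : ∀ g₁ : Bond (d + 1), (∑' z : Site (d + 1), ∑ l : Fin (d + 1), vh (l, z) g₁ * ℐ₁ H' B l z) = ∑ g ∈ P, vh g g₁ * ℐ₁ H' B g.1 g.2 :=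
        fun g₁ => tsum_sum_eq_finset_sum P (fun g => vh g g₁ * ℐ₁ H' B g.1 g.2) fun g hg => by simp only [hvh g g₁ (Or.inl hg), zero_mul]
      have e2 : (∑' u : Site (d + 1), ∑ κ' : Fin (d + 1), (∑' z : Site (d + 1), ∑ l : Fin (d + 1), vh (l, z) (κ', u) * ℐ₁ H' B l z) * Cf H κ' u)
          = ∑ g₁ ∈ P, (∑ g ∈ P, vh g g₁ * ℐ₁ H' B g.1 g.2) * Cf H g₁.1 g₁.2 := by
        rw [tsum_congr fun u => Finset.sum_congr rfl fun κ' _ => by rw [e1]]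
        exact tsum_sum_eq_finset_sum P (fun g₁ => (∑ g ∈ P, vh g g₁ * ℐ₁ H' B g.1 g.2) * Cf H g₁.1 g₁.2) fun g₁ hg₁ => by
          rw [Finset.sum_eq_zero fun g _ => by rw [hvh g g₁ (Or.inr hg₁), zero_mul], zero_mul]
      rw [e2, Finset.mul_sum, Finset.sum_product_right]
      refine Finset.sum_congr rfl fun g₁ _ => ?_
      rw [Finset.sum_mul, Finset.mul_sum]
      exact Finset.sum_congr rfl fun g _ => by rw [eCH]; ring
    -- (C) the second mixed component
    have eC : (∑ q ∈ P ×ˢ P, θ * vh q.1 q.2 * CH' q.2 * ∑' u : Site (d + 1), ∑ κ₁ : Fin (d + 1), KB q.1 (κ₁, u) * H κ₁ u)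
        = θ * (∑' u : Site (d + 1), ∑ κ' : Fin (d + 1), (∑' z : Site (d + 1), ∑ l : Fin (d + 1), vh (l, z) (κ', u) * ℐ₁ H B l z) * Cf H' κ' u) := by
      have e1 : ∀ g₂ : Bond (d + 1), (∑' z : Site (d + 1), ∑ l : Fin (d + 1), vh (l, z) g₂ * ℐ₁ H B l z) = ∑ g ∈ P, vh g g₂ * ℐ₁ H B g.1 g.2 :=
        fun g₂ => tsum_sum_eq_finset_sum P (fun g => vh g g₂ * ℐ₁ H B g.1 g.2) fun g hg => by simp only [hvh g g₂ (Or.inl hg), zero_mul]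
      have e2 : (∑' u : Site (d + 1), ∑ κ' : Fin (d + 1), (∑' z : Site (d + 1), ∑ l : Fin (d + 1), vh (l, z) (κ', u) * ℐ₁ H B l z) * Cf H' κ' u)
          = ∑ g₂ ∈ P, (∑ g ∈ P, vh g g₂ * ℐ₁ H B g.1 g.2) * Cf H' g₂.1 g₂.2 := by
        rw [tsum_congr fun u => Finset.sum_congr rfl fun κ' _ => by rw [e1]]
        exact tsum_sum_eq_finset_sum P (fun g₂ => (∑ g ∈ P, vh g g₂ * ℐ₁ H B g.1 g.2) * Cf H' g₂.1 g₂.2) fun g₂ hg₂ => by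
          rw [Finset.sum_eq_zero fun g _ => by rw [hvh g g₂ (Or.inr hg₂), zero_mul], zero_mul]
      rw [e2, Finset.mul_sum, Finset.sum_product_right]
      refine Finset.sum_congr rfl fun g₂ _ => ?_
      rw [Finset.sum_mul, Finset.mul_sum]
      exact Finset.sum_congr rfl fun g _ => by rw [eCH', eKB]; ring
    -- (D) the lower component
    have eD : (∑ g ∈ P, s * a g * ∑' u : Site (d + 1), ∑ κ₁ : Fin (d + 1), WBH' g (κ₁, u) * H κ₁ u) = s * Af (ℐ₂ H H' B) κ x := by
      rw [hAf, tsum_sum_eq_finset_sum P (fun g => a g * ℐ₂ H H' B g.1 g.2) fun g hg => by simp only [ha g hg, zero_mul], Finset.mul_sum]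
      exact Finset.sum_congr rfl fun g _ => by rw [eWBH']; ring
    rw [eA, eB, eC, eD]; ring
  · rcases i with (q | q) | (q | g)
    · exact hc q.2.1 κ₁ u hu
    · exact hc q.2 κ₁ u hu
    · show (∑' z : Site (d + 1), ∑ l : Fin (d + 1), 𝒦 q.1 (l, z) (κ₁, u) * B l z) = 0
      exact (tsum_congr fun z => Finset.sum_eq_zero fun l _ => by rw [hKu q.1 (l, z) κ₁ u hu, zero_mul]).trans tsum_zero
    · show (∑' u' : Site (d + 1), ∑ κ₂ : Fin (d + 1), WB g (κ₁, u) (κ₂, u') * H' κ₂ u') = 0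
      refine (tsum_congr fun u' => Finset.sum_eq_zero fun κ₂ _ => ?_).trans tsum_zero
      rw [show WB g (κ₁, u) (κ₂, u') = 0 from (tsum_congr fun z => Finset.sum_eq_zero fun l _ => by rw [hW₁ g (l, z) κ₁ _ u hu, zero_mul]).trans tsum_zero,
        zero_mul]

end Summit.QuantumFields.BalabanUV.Beta.FP.CompositeKernelFunctionalStep

end
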